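import Mathlib
import Summits.Ventures.PercRepro2.Defs
import Summits.Ventures.PercRepro2.Independence
import Summits.Ventures.PercRepro2.ZCTwoEdge

/-!
# Theorem J (MINE-A.md §74.5) — the four cells of the two edges at `a₃`, mirror placement
`a₃` between `o` and a non-mark `w` (blind cell PercRepro2, mine-a g25)

Bookkeeping for `ZCA3OW.lean`: with `f₁ = a₃o`, `f₂ = a₃w` and the events of `G − a₃` `A = {a₁ ↔ o}`,
`W = {a₁ ↔ w}`, `Γ = {o ↔ w}`, `X₀ = {C(a₁) ∈ 𝒰}`, `X₁ = {C(a₁) ∪ {a₃} ∈ 𝒰}`, `X₂ = {C(a₁) ∪ C(w) ∪ {a₃} ∈ 𝒰}`,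
`X₃ = {C(a₁) ∪ C(o) ∪ {a₃} ∈ 𝒰}` (all ignoring `f₁`, `f₂`), the (ZC) events of `G` are
`e = ({f₁ open} ∩ A) ∪ ({f₂ open} ∩ W)`, `L = A ∪ ({f₁, f₂ open} ∩ W)`, `γ = {f₁ open} ∪ ({f₂ open} ∩ Γ)`,
`U = ({f₁, f₂} ∩ A ∩ Wᶜ ∩ X₂) ∪ ({f₁, f₂} ∩ Aᶜ ∩ W ∩ X₃) ∪ (e ∩ ({f₁, f₂} ∩ ((A ∩ Wᶜ) ∪ (Aᶜ ∩ W)))ᶜ ∩ X₁) ∪ (eᶜ ∩ X₀)`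
(Theorem I with the roles of `e` and `L` exchanged), and the seven probabilities of (ZC) expand over the
four states of `(f₁, f₂)` (`prob_two_pin`) into probabilities of events of `G − a₃`: `a3ow_prob_eL`,
`a3ow_prob_enL`, `a3ow_prob_UeL`, `a3ow_prob_UenL`, `a3ow_prob_U`, `a3ow_prob_B`, `a3ow_prob_D`.  One seat.
-/

namespace Summit.Ventures.PercRepro2

section CellsJ

variable {E : Type*} [Fintype E] [DecidableEq E] {R : Type*} [CommRing R]
  (p : E → R) {f₁ f₂ : E} (hf : f₁ ≠ f₂) {A W Γ X₀ X₁ X₂ X₃ : Set (Config E)}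
  (hA : ∀ (ω : Config E) (b₁ b₂ : Bool), Function.update (Function.update ω f₁ b₁) f₂ b₂ ∈ A ↔ ω ∈ A)
  (hW : ∀ (ω : Config E) (b₁ b₂ : Bool), Function.update (Function.update ω f₁ b₁) f₂ b₂ ∈ W ↔ ω ∈ W)
  (hΓ : ∀ (ω : Config E) (b₁ b₂ : Bool), Function.update (Function.update ω f₁ b₁) f₂ b₂ ∈ Γ ↔ ω ∈ Γ)
  (hX₀ : ∀ (ω : Config E) (b₁ b₂ : Bool), Function.update (Function.update ω f₁ b₁) f₂ b₂ ∈ X₀ ↔ ω ∈ X₀)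
  (hX₁ : ∀ (ω : Config E) (b₁ b₂ : Bool), Function.update (Function.update ω f₁ b₁) f₂ b₂ ∈ X₁ ↔ ω ∈ X₁)
  (hX₂ : ∀ (ω : Config E) (b₁ b₂ : Bool), Function.update (Function.update ω f₁ b₁) f₂ b₂ ∈ X₂ ↔ ω ∈ X₂)
  (hX₃ : ∀ (ω : Config E) (b₁ b₂ : Bool), Function.update (Function.update ω f₁ b₁) f₂ b₂ ∈ X₃ ↔ ω ∈ X₃)

include hf hA hW in
/-- The cell expansion of `P(e ∩ L)`. -/
lemma a3ow_prob_eL :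
    prob p (((openEdge f₁ ∩ A) ∪ (openEdge f₂ ∩ W)) ∩ (A ∪ (openEdge f₁ ∩ openEdge f₂ ∩ W)))
      = p f₁ * p f₂ * prob p (A ∪ W) + p f₁ * (1 - p f₂) * prob p A
        + (1 - p f₁) * p f₂ * prob p (A ∩ W) := by
  have hs1 := update2_fst hf
  rw [prob_two_pin p hf]
  have e11 : {ω | Function.update (Function.update ω f₁ true) f₂ true ∈
      ((openEdge f₁ ∩ A) ∪ (openEdge f₂ ∩ W)) ∩ (A ∪ (openEdge f₁ ∩ openEdge f₂ ∩ W))} = A ∪ W := by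
    ext ω; simp [hs1, hA, hW]
  have e10 : {ω | Function.update (Function.update ω f₁ true) f₂ false ∈
      ((openEdge f₁ ∩ A) ∪ (openEdge f₂ ∩ W)) ∩ (A ∪ (openEdge f₁ ∩ openEdge f₂ ∩ W))} = A := by
    ext ω; simp [hs1, hA, hW]
  have e01 : {ω | Function.update (Function.update ω f₁ false) f₂ true ∈
      ((openEdge f₁ ∩ A) ∪ (openEdge f₂ ∩ W)) ∩ (A ∪ (openEdge f₁ ∩ openEdge f₂ ∩ W))} = A ∩ W := by
    ext ω; simp [hs1, hA, hW]; tauto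
  have e00 : {ω | Function.update (Function.update ω f₁ false) f₂ false ∈
      ((openEdge f₁ ∩ A) ∪ (openEdge f₂ ∩ W)) ∩ (A ∪ (openEdge f₁ ∩ openEdge f₂ ∩ W))} = ∅ := by
    ext ω; simp [hs1, hA, hW]
  rw [e11, e10, e01, e00, prob_empty]; ring

include hf hA hW in
/-- The cell expansion of `P(e ∩ Lᶜ)`. -/
lemma a3ow_prob_enL :
    prob p (((openEdge f₁ ∩ A) ∪ (openEdge f₂ ∩ W)) ∩ (A ∪ (openEdge f₁ ∩ openEdge f₂ ∩ W))ᶜ)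
      = (1 - p f₁) * p f₂ * prob p (Aᶜ ∩ W) := by
  have hs1 := update2_fst hf
  rw [prob_two_pin p hf]
  have e11 : {ω | Function.update (Function.update ω f₁ true) f₂ true ∈
      ((openEdge f₁ ∩ A) ∪ (openEdge f₂ ∩ W)) ∩ (A ∪ (openEdge f₁ ∩ openEdge f₂ ∩ W))ᶜ} = ∅ := by
    ext ω; simp [hs1, hA, hW]
  have e10 : {ω | Function.update (Function.update ω f₁ true) f₂ false ∈
      ((openEdge f₁ ∩ A) ∪ (openEdge f₂ ∩ W)) ∩ (A ∪ (openEdge f₁ ∩ openEdge f₂ ∩ W))ᶜ} = ∅ := by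
    ext ω; simp [hs1, hA, hW]
  have e01 : {ω | Function.update (Function.update ω f₁ false) f₂ true ∈
      ((openEdge f₁ ∩ A) ∪ (openEdge f₂ ∩ W)) ∩ (A ∪ (openEdge f₁ ∩ openEdge f₂ ∩ W))ᶜ} = Aᶜ ∩ W := by
    ext ω; simp [hs1, hA, hW]; tauto
  have e00 : {ω | Function.update (Function.update ω f₁ false) f₂ false ∈
      ((openEdge f₁ ∩ A) ∪ (openEdge f₂ ∩ W)) ∩ (A ∪ (openEdge f₁ ∩ openEdge f₂ ∩ W))ᶜ} = ∅ := by
    ext ω; simp [hs1, hA, hW]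
  rw [e11, e10, e01, e00, prob_empty]; ring

include hf hA hW hX₁ hX₂ hX₃ in
/-- The cell expansion of `P(U ∩ e ∩ L)`. -/
lemma a3ow_prob_UeL :
    prob p (((openEdge f₁ ∩ openEdge f₂ ∩ A ∩ Wᶜ ∩ X₂) ∪ (openEdge f₁ ∩ openEdge f₂ ∩ Aᶜ ∩ W ∩ X₃)
        ∪ (((openEdge f₁ ∩ A) ∪ (openEdge f₂ ∩ W))
            ∩ (openEdge f₁ ∩ openEdge f₂ ∩ ((A ∩ Wᶜ) ∪ (Aᶜ ∩ W)))ᶜ ∩ X₁)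
        ∪ (((openEdge f₁ ∩ A) ∪ (openEdge f₂ ∩ W))ᶜ ∩ X₀))
      ∩ (((openEdge f₁ ∩ A) ∪ (openEdge f₂ ∩ W)) ∩ (A ∪ (openEdge f₁ ∩ openEdge f₂ ∩ W))))
      = p f₁ * p f₂ * prob p ((A ∩ W ∩ X₁) ∪ (A ∩ Wᶜ ∩ X₂) ∪ (Aᶜ ∩ W ∩ X₃))
        + p f₁ * (1 - p f₂) * prob p (X₁ ∩ A) + (1 - p f₁) * p f₂ * prob p (X₁ ∩ (A ∩ W)) := by
  have hs1 := update2_fst hf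
  rw [prob_two_pin p hf]
  have e11 : {ω | Function.update (Function.update ω f₁ true) f₂ true ∈
      ((openEdge f₁ ∩ openEdge f₂ ∩ A ∩ Wᶜ ∩ X₂) ∪ (openEdge f₁ ∩ openEdge f₂ ∩ Aᶜ ∩ W ∩ X₃)
        ∪ (((openEdge f₁ ∩ A) ∪ (openEdge f₂ ∩ W))
            ∩ (openEdge f₁ ∩ openEdge f₂ ∩ ((A ∩ Wᶜ) ∪ (Aᶜ ∩ W)))ᶜ ∩ X₁)
        ∪ (((openEdge f₁ ∩ A) ∪ (openEdge f₂ ∩ W))ᶜ ∩ X₀))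
      ∩ (((openEdge f₁ ∩ A) ∪ (openEdge f₂ ∩ W)) ∩ (A ∪ (openEdge f₁ ∩ openEdge f₂ ∩ W)))}
      = (A ∩ W ∩ X₁) ∪ (A ∩ Wᶜ ∩ X₂) ∪ (Aᶜ ∩ W ∩ X₃) := by
    ext ω; simp [hs1, hA, hW, hX₁, hX₂, hX₃]; tauto
  have e10 : {ω | Function.update (Function.update ω f₁ true) f₂ false ∈
      ((openEdge f₁ ∩ openEdge f₂ ∩ A ∩ Wᶜ ∩ X₂) ∪ (openEdge f₁ ∩ openEdge f₂ ∩ Aᶜ ∩ W ∩ X₃)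
        ∪ (((openEdge f₁ ∩ A) ∪ (openEdge f₂ ∩ W))
            ∩ (openEdge f₁ ∩ openEdge f₂ ∩ ((A ∩ Wᶜ) ∪ (Aᶜ ∩ W)))ᶜ ∩ X₁)
        ∪ (((openEdge f₁ ∩ A) ∪ (openEdge f₂ ∩ W))ᶜ ∩ X₀))
      ∩ (((openEdge f₁ ∩ A) ∪ (openEdge f₂ ∩ W)) ∩ (A ∪ (openEdge f₁ ∩ openEdge f₂ ∩ W)))}
      = X₁ ∩ A := by
    ext ω; simp [hs1, hA, hW, hX₁]; tauto
  have e01 : {ω | Function.update (Function.update ω f₁ false) f₂ true ∈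
      ((openEdge f₁ ∩ openEdge f₂ ∩ A ∩ Wᶜ ∩ X₂) ∪ (openEdge f₁ ∩ openEdge f₂ ∩ Aᶜ ∩ W ∩ X₃)
        ∪ (((openEdge f₁ ∩ A) ∪ (openEdge f₂ ∩ W))
            ∩ (openEdge f₁ ∩ openEdge f₂ ∩ ((A ∩ Wᶜ) ∪ (Aᶜ ∩ W)))ᶜ ∩ X₁)
        ∪ (((openEdge f₁ ∩ A) ∪ (openEdge f₂ ∩ W))ᶜ ∩ X₀))
      ∩ (((openEdge f₁ ∩ A) ∪ (openEdge f₂ ∩ W)) ∩ (A ∪ (openEdge f₁ ∩ openEdge f₂ ∩ W)))}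
      = X₁ ∩ (A ∩ W) := by
    ext ω; simp [hs1, hA, hW, hX₁]; tauto
  have e00 : {ω | Function.update (Function.update ω f₁ false) f₂ false ∈
      ((openEdge f₁ ∩ openEdge f₂ ∩ A ∩ Wᶜ ∩ X₂) ∪ (openEdge f₁ ∩ openEdge f₂ ∩ Aᶜ ∩ W ∩ X₃)
        ∪ (((openEdge f₁ ∩ A) ∪ (openEdge f₂ ∩ W))
            ∩ (openEdge f₁ ∩ openEdge f₂ ∩ ((A ∩ Wᶜ) ∪ (Aᶜ ∩ W)))ᶜ ∩ X₁)
        ∪ (((openEdge f₁ ∩ A) ∪ (openEdge f₂ ∩ W))ᶜ ∩ X₀))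
      ∩ (((openEdge f₁ ∩ A) ∪ (openEdge f₂ ∩ W)) ∩ (A ∪ (openEdge f₁ ∩ openEdge f₂ ∩ W)))} = ∅ := by
    ext ω; simp [hs1, hA, hW]
  rw [e11, e10, e01, e00, prob_empty]; ring

include hf hA hW hX₁ in
/-- The cell expansion of `P(U ∩ e ∩ Lᶜ)`. -/
lemma a3ow_prob_UenL :
    prob p (((openEdge f₁ ∩ openEdge f₂ ∩ A ∩ Wᶜ ∩ X₂) ∪ (openEdge f₁ ∩ openEdge f₂ ∩ Aᶜ ∩ W ∩ X₃)
        ∪ (((openEdge f₁ ∩ A) ∪ (openEdge f₂ ∩ W))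
            ∩ (openEdge f₁ ∩ openEdge f₂ ∩ ((A ∩ Wᶜ) ∪ (Aᶜ ∩ W)))ᶜ ∩ X₁)
        ∪ (((openEdge f₁ ∩ A) ∪ (openEdge f₂ ∩ W))ᶜ ∩ X₀))
      ∩ (((openEdge f₁ ∩ A) ∪ (openEdge f₂ ∩ W)) ∩ (A ∪ (openEdge f₁ ∩ openEdge f₂ ∩ W))ᶜ))
      = (1 - p f₁) * p f₂ * prob p (X₁ ∩ (Aᶜ ∩ W)) := by
  have hs1 := update2_fst hf
  rw [prob_two_pin p hf]
  have e11 : {ω | Function.update (Function.update ω f₁ true) f₂ true ∈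
      ((openEdge f₁ ∩ openEdge f₂ ∩ A ∩ Wᶜ ∩ X₂) ∪ (openEdge f₁ ∩ openEdge f₂ ∩ Aᶜ ∩ W ∩ X₃)
        ∪ (((openEdge f₁ ∩ A) ∪ (openEdge f₂ ∩ W))
            ∩ (openEdge f₁ ∩ openEdge f₂ ∩ ((A ∩ Wᶜ) ∪ (Aᶜ ∩ W)))ᶜ ∩ X₁)
        ∪ (((openEdge f₁ ∩ A) ∪ (openEdge f₂ ∩ W))ᶜ ∩ X₀))
      ∩ (((openEdge f₁ ∩ A) ∪ (openEdge f₂ ∩ W)) ∩ (A ∪ (openEdge f₁ ∩ openEdge f₂ ∩ W))ᶜ)} = ∅ := by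
    ext ω; simp [hs1, hA, hW]; tauto
  have e10 : {ω | Function.update (Function.update ω f₁ true) f₂ false ∈
      ((openEdge f₁ ∩ openEdge f₂ ∩ A ∩ Wᶜ ∩ X₂) ∪ (openEdge f₁ ∩ openEdge f₂ ∩ Aᶜ ∩ W ∩ X₃)
        ∪ (((openEdge f₁ ∩ A) ∪ (openEdge f₂ ∩ W))
            ∩ (openEdge f₁ ∩ openEdge f₂ ∩ ((A ∩ Wᶜ) ∪ (Aᶜ ∩ W)))ᶜ ∩ X₁)
        ∪ (((openEdge f₁ ∩ A) ∪ (openEdge f₂ ∩ W))ᶜ ∩ X₀))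
      ∩ (((openEdge f₁ ∩ A) ∪ (openEdge f₂ ∩ W)) ∩ (A ∪ (openEdge f₁ ∩ openEdge f₂ ∩ W))ᶜ)} = ∅ := by
    ext ω; simp [hs1, hA, hW]
  have e01 : {ω | Function.update (Function.update ω f₁ false) f₂ true ∈
      ((openEdge f₁ ∩ openEdge f₂ ∩ A ∩ Wᶜ ∩ X₂) ∪ (openEdge f₁ ∩ openEdge f₂ ∩ Aᶜ ∩ W ∩ X₃)
        ∪ (((openEdge f₁ ∩ A) ∪ (openEdge f₂ ∩ W))
            ∩ (openEdge f₁ ∩ openEdge f₂ ∩ ((A ∩ Wᶜ) ∪ (Aᶜ ∩ W)))ᶜ ∩ X₁)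
        ∪ (((openEdge f₁ ∩ A) ∪ (openEdge f₂ ∩ W))ᶜ ∩ X₀))
      ∩ (((openEdge f₁ ∩ A) ∪ (openEdge f₂ ∩ W)) ∩ (A ∪ (openEdge f₁ ∩ openEdge f₂ ∩ W))ᶜ)}
      = X₁ ∩ (Aᶜ ∩ W) := by
    ext ω; simp [hs1, hA, hW, hX₁]; tauto
  have e00 : {ω | Function.update (Function.update ω f₁ false) f₂ false ∈
      ((openEdge f₁ ∩ openEdge f₂ ∩ A ∩ Wᶜ ∩ X₂) ∪ (openEdge f₁ ∩ openEdge f₂ ∩ Aᶜ ∩ W ∩ X₃)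
        ∪ (((openEdge f₁ ∩ A) ∪ (openEdge f₂ ∩ W))
            ∩ (openEdge f₁ ∩ openEdge f₂ ∩ ((A ∩ Wᶜ) ∪ (Aᶜ ∩ W)))ᶜ ∩ X₁)
        ∪ (((openEdge f₁ ∩ A) ∪ (openEdge f₂ ∩ W))ᶜ ∩ X₀))
      ∩ (((openEdge f₁ ∩ A) ∪ (openEdge f₂ ∩ W)) ∩ (A ∪ (openEdge f₁ ∩ openEdge f₂ ∩ W))ᶜ)}
      = ∅ := by
    ext ω; simp [hs1, hA, hW]
  rw [e11, e10, e01, e00, prob_empty]; ring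

include hf hA hW hX₀ hX₁ hX₂ hX₃ in
/-- The cell expansion of `P(U)`. -/
lemma a3ow_prob_U :
    prob p ((openEdge f₁ ∩ openEdge f₂ ∩ A ∩ Wᶜ ∩ X₂) ∪ (openEdge f₁ ∩ openEdge f₂ ∩ Aᶜ ∩ W ∩ X₃)
        ∪ (((openEdge f₁ ∩ A) ∪ (openEdge f₂ ∩ W))
            ∩ (openEdge f₁ ∩ openEdge f₂ ∩ ((A ∩ Wᶜ) ∪ (Aᶜ ∩ W)))ᶜ ∩ X₁)
        ∪ (((openEdge f₁ ∩ A) ∪ (openEdge f₂ ∩ W))ᶜ ∩ X₀))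
      = p f₁ * p f₂ * prob p ((A ∩ W ∩ X₁) ∪ (A ∩ Wᶜ ∩ X₂) ∪ (Aᶜ ∩ W ∩ X₃) ∪ (Aᶜ ∩ Wᶜ ∩ X₀))
        + p f₁ * (1 - p f₂) * prob p ((A ∩ X₁) ∪ (Aᶜ ∩ X₀))
        + (1 - p f₁) * p f₂ * prob p ((W ∩ X₁) ∪ (Wᶜ ∩ X₀)) + (1 - p f₁) * (1 - p f₂) * prob p X₀ := by
  have hs1 := update2_fst hf
  rw [prob_two_pin p hf]
  have e11 : {ω | Function.update (Function.update ω f₁ true) f₂ true ∈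
      ((openEdge f₁ ∩ openEdge f₂ ∩ A ∩ Wᶜ ∩ X₂) ∪ (openEdge f₁ ∩ openEdge f₂ ∩ Aᶜ ∩ W ∩ X₃)
        ∪ (((openEdge f₁ ∩ A) ∪ (openEdge f₂ ∩ W))
            ∩ (openEdge f₁ ∩ openEdge f₂ ∩ ((A ∩ Wᶜ) ∪ (Aᶜ ∩ W)))ᶜ ∩ X₁)
        ∪ (((openEdge f₁ ∩ A) ∪ (openEdge f₂ ∩ W))ᶜ ∩ X₀))}
      = (A ∩ W ∩ X₁) ∪ (A ∩ Wᶜ ∩ X₂) ∪ (Aᶜ ∩ W ∩ X₃) ∪ (Aᶜ ∩ Wᶜ ∩ X₀) := by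
    ext ω; simp [hs1, hA, hW, hX₀, hX₁, hX₂, hX₃]; tauto
  have e10 : {ω | Function.update (Function.update ω f₁ true) f₂ false ∈
      ((openEdge f₁ ∩ openEdge f₂ ∩ A ∩ Wᶜ ∩ X₂) ∪ (openEdge f₁ ∩ openEdge f₂ ∩ Aᶜ ∩ W ∩ X₃)
        ∪ (((openEdge f₁ ∩ A) ∪ (openEdge f₂ ∩ W))
            ∩ (openEdge f₁ ∩ openEdge f₂ ∩ ((A ∩ Wᶜ) ∪ (Aᶜ ∩ W)))ᶜ ∩ X₁)
        ∪ (((openEdge f₁ ∩ A) ∪ (openEdge f₂ ∩ W))ᶜ ∩ X₀))}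
      = (A ∩ X₁) ∪ (Aᶜ ∩ X₀) := by
    ext ω; simp [hs1, hA, hW, hX₀, hX₁]
  have e01 : {ω | Function.update (Function.update ω f₁ false) f₂ true ∈
      ((openEdge f₁ ∩ openEdge f₂ ∩ A ∩ Wᶜ ∩ X₂) ∪ (openEdge f₁ ∩ openEdge f₂ ∩ Aᶜ ∩ W ∩ X₃)
        ∪ (((openEdge f₁ ∩ A) ∪ (openEdge f₂ ∩ W))
            ∩ (openEdge f₁ ∩ openEdge f₂ ∩ ((A ∩ Wᶜ) ∪ (Aᶜ ∩ W)))ᶜ ∩ X₁)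
        ∪ (((openEdge f₁ ∩ A) ∪ (openEdge f₂ ∩ W))ᶜ ∩ X₀))}
      = (W ∩ X₁) ∪ (Wᶜ ∩ X₀) := by
    ext ω; simp [hs1, hA, hW, hX₀, hX₁]
  have e00 : {ω | Function.update (Function.update ω f₁ false) f₂ false ∈
      ((openEdge f₁ ∩ openEdge f₂ ∩ A ∩ Wᶜ ∩ X₂) ∪ (openEdge f₁ ∩ openEdge f₂ ∩ Aᶜ ∩ W ∩ X₃)
        ∪ (((openEdge f₁ ∩ A) ∪ (openEdge f₂ ∩ W))
            ∩ (openEdge f₁ ∩ openEdge f₂ ∩ ((A ∩ Wᶜ) ∪ (Aᶜ ∩ W)))ᶜ ∩ X₁)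
        ∪ (((openEdge f₁ ∩ A) ∪ (openEdge f₂ ∩ W))ᶜ ∩ X₀))} = X₀ := by
    ext ω; simp [hs1, hA, hW, hX₀]
  rw [e11, e10, e01, e00]

include hf hA hW hΓ in
/-- The cell expansion of `P(B) = P(eᶜ ∩ Lᶜ ∩ γ)`. -/
lemma a3ow_prob_B :
    prob p (((openEdge f₁ ∩ A) ∪ (openEdge f₂ ∩ W))ᶜ ∩ (A ∪ (openEdge f₁ ∩ openEdge f₂ ∩ W))ᶜ
        ∩ (openEdge f₁ ∪ (openEdge f₂ ∩ Γ)))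
      = p f₁ * p f₂ * prob p (Aᶜ ∩ Wᶜ) + p f₁ * (1 - p f₂) * prob p Aᶜ
        + (1 - p f₁) * p f₂ * prob p (Aᶜ ∩ Wᶜ ∩ Γ) := by
  have hs1 := update2_fst hf
  rw [prob_two_pin p hf]
  have e11 : {ω | Function.update (Function.update ω f₁ true) f₂ true ∈
      (((openEdge f₁ ∩ A) ∪ (openEdge f₂ ∩ W))ᶜ ∩ (A ∪ (openEdge f₁ ∩ openEdge f₂ ∩ W))ᶜ
        ∩ (openEdge f₁ ∪ (openEdge f₂ ∩ Γ)))} = Aᶜ ∩ Wᶜ := by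
    ext ω; simp [hs1, hA, hW, hΓ]
  have e10 : {ω | Function.update (Function.update ω f₁ true) f₂ false ∈
      (((openEdge f₁ ∩ A) ∪ (openEdge f₂ ∩ W))ᶜ ∩ (A ∪ (openEdge f₁ ∩ openEdge f₂ ∩ W))ᶜ
        ∩ (openEdge f₁ ∪ (openEdge f₂ ∩ Γ)))} = Aᶜ := by
    ext ω; simp [hs1, hA, hW, hΓ]
  have e01 : {ω | Function.update (Function.update ω f₁ false) f₂ true ∈
      (((openEdge f₁ ∩ A) ∪ (openEdge f₂ ∩ W))ᶜ ∩ (A ∪ (openEdge f₁ ∩ openEdge f₂ ∩ W))ᶜ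
        ∩ (openEdge f₁ ∪ (openEdge f₂ ∩ Γ)))} = Aᶜ ∩ Wᶜ ∩ Γ := by
    ext ω; simp [hs1, hA, hW, hΓ]; tauto
  have e00 : {ω | Function.update (Function.update ω f₁ false) f₂ false ∈
      (((openEdge f₁ ∩ A) ∪ (openEdge f₂ ∩ W))ᶜ ∩ (A ∪ (openEdge f₁ ∩ openEdge f₂ ∩ W))ᶜ
        ∩ (openEdge f₁ ∪ (openEdge f₂ ∩ Γ)))} = ∅ := by
    ext ω; simp [hs1]
  rw [e11, e10, e01, e00, prob_empty]; ring

include hf hA hW hΓ in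
/-- The cell expansion of `P(D) = P(eᶜ ∩ Lᶜ ∩ γᶜ)`. -/
lemma a3ow_prob_D :
    prob p (((openEdge f₁ ∩ A) ∪ (openEdge f₂ ∩ W))ᶜ ∩ (A ∪ (openEdge f₁ ∩ openEdge f₂ ∩ W))ᶜ
        ∩ (openEdge f₁ ∪ (openEdge f₂ ∩ Γ))ᶜ)
      = (1 - p f₁) * p f₂ * prob p (Aᶜ ∩ Wᶜ ∩ Γᶜ) + (1 - p f₁) * (1 - p f₂) * prob p Aᶜ := by
  have hs1 := update2_fst hf
  rw [prob_two_pin p hf]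
  have e11 : {ω | Function.update (Function.update ω f₁ true) f₂ true ∈
      (((openEdge f₁ ∩ A) ∪ (openEdge f₂ ∩ W))ᶜ ∩ (A ∪ (openEdge f₁ ∩ openEdge f₂ ∩ W))ᶜ
        ∩ (openEdge f₁ ∪ (openEdge f₂ ∩ Γ))ᶜ)} = ∅ := by
    ext ω; simp [hs1]
  have e10 : {ω | Function.update (Function.update ω f₁ true) f₂ false ∈
      (((openEdge f₁ ∩ A) ∪ (openEdge f₂ ∩ W))ᶜ ∩ (A ∪ (openEdge f₁ ∩ openEdge f₂ ∩ W))ᶜ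
        ∩ (openEdge f₁ ∪ (openEdge f₂ ∩ Γ))ᶜ)} = ∅ := by
    ext ω; simp [hs1]
  have e01 : {ω | Function.update (Function.update ω f₁ false) f₂ true ∈
      (((openEdge f₁ ∩ A) ∪ (openEdge f₂ ∩ W))ᶜ ∩ (A ∪ (openEdge f₁ ∩ openEdge f₂ ∩ W))ᶜ
        ∩ (openEdge f₁ ∪ (openEdge f₂ ∩ Γ))ᶜ)} = Aᶜ ∩ Wᶜ ∩ Γᶜ := by
    ext ω; simp [hs1, hA, hW, hΓ]; tauto
  have e00 : {ω | Function.update (Function.update ω f₁ false) f₂ false ∈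
      (((openEdge f₁ ∩ A) ∪ (openEdge f₂ ∩ W))ᶜ ∩ (A ∪ (openEdge f₁ ∩ openEdge f₂ ∩ W))ᶜ
        ∩ (openEdge f₁ ∪ (openEdge f₂ ∩ Γ))ᶜ)} = Aᶜ := by
    ext ω; simp [hs1, hA, hW, hΓ]
  rw [e11, e10, e01, e00, prob_empty]; ring

end CellsJ

end Summit.Ventures.PercRepro2
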